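import Literature.InformationTheory.Coding.PlotkinBound
import HarnessLib

/-!
# The values of `A(n,d)` in the Plotkin range `n ≤ 2d` (`d` even) / `n ≤ 2d + 1` (`d` odd) for `d ≤ 12`:
# Levenshtein's equalities from the Paley–Hadamard matrices `H₈, H₁₂, H₂₀, H₂₄` and pasted codes
# (MacWilliams–Sloane Ch. 2 §§2–3, Appendix A Fig. 1)

Layer `Literature/InformationTheory/Coding`, namespace `Literature.InformationTheory.Coding` (lane `lit-hodgefound`,
Layer A4, row A4-17 lineage; prover seat `lit-hodgefound-p23`, row «A4-17(cm)»). Sequel of `PlotkinBound.lean`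
(Theorem 1 / Corollary 4 and the Sylvester–Hadamard codes), which settled the powers of two; this file adds the
lengths that need Paley's construction (Ch. 2 §3 Construction II) and Levenshtein's pasting `a𝒞₁ ⊕ b𝒞₂`
(Theorem 8, proof), by exhibiting the finite codes and letting the kernel check their distances.

* §1 general facts: lengthening `A(n,d) ≤ A(n+1,d)` (`maxCodeSize_le_succ_left`, `maxCodeSize_mono_left`);
  **`A(n,d) = 2` for `d ≤ n < 3d/2`** (`maxCodeSize_eq_two`: Plotkin gives `2⌊d/(2d−n)⌋ = 2`); the three-block code
  `{0³ᵏ, 1²ᵏ0ᵏ, 0ᵏ1²ᵏ, 1ᵏ0ᵏ1ᵏ}` (`ThreeBlock.code`, a `(3k, 4, 2k)` code) and **`A(n, 2k) = 4` for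
  `3k ≤ n < 10k/3`** (`maxCodeSize_eq_four`), with the odd-`d` twins by Theorem 2.
* §2 **Paley's Hadamard codes** for `p = 7, 11, 19, 23` (`Paley.row p i j = [j = i ∨ j − i is a non-square mod p]`,
  the rows of the binary matrix of `Q − I`; `Paley.codeA p` = these rows and `0` = the code `𝒜_{p+1}`, a
  `(p, p+1, (p+1)/2)` code; `Paley.codeB p` = `𝒜 ∪` complements = `ℬ_{p+1}`, a `(p, 2p+2, (p−1)/2)` code): sizes and
  distances certified by the kernel (`Paley.cert_eleven : Cert 11 6`, …) and turned into sizes / minimum distances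
  by `card_codeA`, `hammingDist_of_mem_codeA`, `card_codeB`, `le_hammingDist_of_mem_codeB`.
* §3 **Levenshtein's pasted codes** `(17, 6, 10) = 𝒜'₁₂ ⊕ 𝒜₈`, `(20, 6, 12) = 𝒜'₁₂ ⊕ 𝒜'₁₂`,
  `(21, 8, 12) = 𝒜'₁₆ ⊕ 𝒜₈` (explicit words, distances by `decide`).
* §4 **the values** (each `= ` Plotkin's bound (3)/(4), attained): `A(10,6) = 6`, `A(11,6) = 12`, `A(12,6) = 24`,
  `A(14,8) = 8`, `A(17,10) = 6`, `A(18,10) = 10`, `A(19,10) = 20`, `A(20,10) = 40`, `A(20,12) = 6`, `A(21,12) = 8`,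
  `A(22,12) = 12`, `A(23,12) = 24`, `A(24,12) = 48`, and by Theorem 2 the odd-`d` column entries of Appendix A
  Fig. 1 in the Plotkin range: `A(n,5)` (`5 ≤ n ≤ 11`), `A(n,7)` (`7 ≤ n ≤ 13`), `A(n,9)` (`9 ≤ n ≤ 19`), and
  `A(n,11)` (`11 ≤ n ≤ 23`).

NOT formalised: Paley's construction for a general prime power `q ≡ 3 (mod 4)` (Lemma 7, (8)), Theorem 8 in
general, the classification statements of §3.

## References

* F. J. MacWilliams, N. J. A. Sloane, *The Theory of Error-Correcting Codes*, North-Holland 1977, Ch. 2 §2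
  (Theorems 1–3, Corollary 4, Example "(11, 12, 6) code 𝒜₁₂"), §3 (Construction II (Paley), Lemma 7, (8),
  Hadamard codes (i)–(iii) `𝒜_n, ℬ_n, 𝒞_n`, the codes `𝒜'_n`, the pasting `a𝒞₁ ⊕ b𝒞₂`, Theorem 8 (Levenshtein)
  (9)–(12)), §1 Fig. 2.1 (`𝒜₁₂`, `ℬ₁₂`); Appendix A Fig. 1 (values of `A(n,d)`, `d = 3, 5, 7, 9`). Held
  (`lit read book:macwilliamsnd-theory-error-correcting-codes-gx73440325`, chunks p0042–p0048, p0522).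
-/

namespace Literature.InformationTheory.Coding

open Finset

/-! ### §1 Lengthening; the ranges `A(n,d) = 2` and `A(n,d) = 4` -/

section General

variable {n d k : ℕ}

/-- **Lengthening**: appending a fixed letter maps a code of length `n` to one of length `n + 1` with the same
distances, so `A(n,d) ≤ A(n+1,d)`. [cite: MacWilliamsSloane1977, Ch. 1 §9 (IV) "extending"/"lengthening" codes
(p0034); Ch. 2 §2 (A(n,d) as a maximum) (p0043)] -/
theorem maxCodeSize_le_succ_left (n d : ℕ) : maxCodeSize n d ≤ maxCodeSize (n + 1) d := by
  refine maxCodeSize_le_of_map (fun u => (Fin.cons false u : Fin (n + 1) → Bool)) fun u v huv hdist => ?_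
  refine ⟨fun h => huv ?_, ?_⟩
  · have := congrArg Fin.tail h
    rwa [Fin.tail_cons, Fin.tail_cons] at this
  · rw [hammingDist_cons]
    simpa using hdist

/-- `A(m,d) ≤ A(n,d)` for `m ≤ n`. [cite: MacWilliamsSloane1977, Ch. 2 §2 (p0043)] -/
theorem maxCodeSize_mono_left (d : ℕ) {m n : ℕ} (h : m ≤ n) : maxCodeSize m d ≤ maxCodeSize n d := by
  induction h with
  | refl => exact le_rfl
  | step _ ih => exact ih.trans (maxCodeSize_le_succ_left _ _)

/-- `A(n,d) ≥ 2` for `1 ≤ n`, `d ≤ n` (a word and its complement). [cite: MacWilliamsSloane1977, Ch. 2 §3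
Theorem 8 (9) (the case `[d/(2d−n)] = 1`) (p0047)] -/
theorem two_le_maxCodeSize (hdn : d ≤ n) (hn : 0 < n) : 2 ≤ maxCodeSize n d :=
  (maxCodeSize_self_of_pos hn).symm.le.trans (maxCodeSize_anti n hdn)

/-- **`A(n,d) = 2` for `d ≤ n` and `2n < 3d`** (Plotkin: `A(n,d) ≤ 2⌊d/(2d − n)⌋ = 2`).
[cite: MacWilliamsSloane1977, Ch. 2 §2 Theorem 1 (1) (p0042); §3 Theorem 8 (9) (p0047)] -/
theorem maxCodeSize_eq_two (hdn : d ≤ n) (hn : 0 < n) (h : 2 * n < 3 * d) : maxCodeSize n d = 2 := by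
  refine le_antisymm ?_ (two_le_maxCodeSize hdn hn)
  have hp := maxCodeSize_le_plotkin hdn (by omega)
  have h1 : d / (2 * d - n) ≤ 1 := (Nat.div_le_iff_le_mul_add_pred (by omega)).2 (by omega)
  omega

namespace ThreeBlock

/-- The word on `Fin 3 × Fin k` that is constant on each of the three blocks, with block pattern `S ⊆ {0,1,2}`.
[cite: MacWilliamsSloane1977, Ch. 2 §3 Theorem 8 (proof: pasting copies of codes side by side, (ii)) (p0047)] -/
def word (k : ℕ) (S : Finset (Fin 3)) : Fin 3 × Fin k → Bool := fun x => decide (x.1 ∈ S)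

/-- Two block words differ in `k · |S ∆ T|` places. [cite: MacWilliamsSloane1977, Ch. 2 §3 (ii) "d ≥ ad₁ + bd₂"
(p0047)] -/
theorem hammingDist_word (k : ℕ) (S T : Finset (Fin 3)) :
    hammingDist (word k S) (word k T) = #(symmDiff S T) * k := by
  rw [hammingDist]
  have h : (univ.filter fun x : Fin 3 × Fin k => word k S x ≠ word k T x) =
      symmDiff S T ×ˢ (univ : Finset (Fin k)) := by
    ext ⟨a, b⟩
    simp only [word, mem_filter, mem_univ, true_and, mem_product, and_true, Finset.mem_symmDiff, ne_eq,
      decide_eq_decide]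
    tauto
  rw [h, card_product, card_univ, Fintype.card_fin]

/-- The four block patterns `∅, {0,1}, {1,2}, {0,2}`, pairwise with symmetric difference of size `2`. [folklore] -/
private def patterns : Finset (Finset (Fin 3)) := {∅, {0, 1}, {1, 2}, {0, 2}}

/-- **The three-block code** `{0³ᵏ, 1ᵏ1ᵏ0ᵏ, 0ᵏ1ᵏ1ᵏ, 1ᵏ0ᵏ1ᵏ}`: four words of length `3k` pairwise at distance
`2k` (the simplest instance of Levenshtein's pasting). [cite: MacWilliamsSloane1977, Ch. 2 §3 Theorem 8 (proof,
(ii) and (13)) (p0047–p0048)] -/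
def code (k : ℕ) : Finset (Fin 3 × Fin k → Bool) := patterns.image (word k)

/-- The patterns pairwise have symmetric difference of size `2`. [folklore] -/
private theorem patterns_symmDiff : ∀ S ∈ patterns, ∀ T ∈ patterns, S ≠ T → #(symmDiff S T) = 2 := by
  decide

/-- For `k ≥ 1` the code has `4` words. [cite: MacWilliamsSloane1977, Ch. 2 §3 Theorem 8 (proof) (p0048)] -/
theorem card_code (hk : 0 < k) : #(code k) = 4 := by
  rw [code, card_image_of_injOn, show #patterns = 4 by decide]
  intro S _ T _ h
  ext a
  have := congrFun h (a, ⟨0, hk⟩)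
  simpa [word] using this

/-- Distinct words of the three-block code are at distance exactly `2k`. [cite: MacWilliamsSloane1977, Ch. 2 §3
Theorem 8 (proof) (p0048)] -/
theorem hammingDist_of_mem_code {u v : Fin 3 × Fin k → Bool} (hu : u ∈ code k) (hv : v ∈ code k) (huv : u ≠ v) :
    hammingDist u v = 2 * k := by
  obtain ⟨S, hS, rfl⟩ := mem_image.1 hu
  obtain ⟨T, hT, rfl⟩ := mem_image.1 hv
  rw [hammingDist_word, patterns_symmDiff S hS T hT fun h => huv (by rw [h])]

end ThreeBlock

/-- **`A(3k, 2k) ≥ 4`** (the three-block code). [cite: MacWilliamsSloane1977, Ch. 2 §3 Theorem 8 (9) with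
`[d/(2d−n)] = 2` (p0047)] -/
theorem four_le_maxCodeSize_three_mul (hk : 0 < k) : 4 ≤ maxCodeSize (3 * k) (2 * k) := by
  have h := card_le_maxCodeSize_of_equiv (finProdFinEquiv.symm : Fin (3 * k) ≃ Fin 3 × Fin k)
    Function.injective_id (C := ThreeBlock.code k) (d := 2 * k) fun u hu v hv huv =>
      (ThreeBlock.hammingDist_of_mem_code (mem_coe.1 hu) (mem_coe.1 hv) huv).symm.le
  rwa [ThreeBlock.card_code hk] at h

/-- **`A(n, 2k) = 4` for `3k ≤ n < 10k/3`** (`k ≥ 1`): Plotkin gives `2⌊2k/(4k − n)⌋ = 4`, attained by the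
(lengthened) three-block code. [cite: MacWilliamsSloane1977, Ch. 2 §2 Theorem 1 (1) (p0042); §3 Theorem 8 (9)
(p0047)] -/
theorem maxCodeSize_eq_four (hk : 0 < k) (h1 : 3 * k ≤ n) (h2 : 3 * n < 10 * k) : maxCodeSize n (2 * k) = 4 := by
  refine le_antisymm ?_ ((four_le_maxCodeSize_three_mul hk).trans (maxCodeSize_mono_left _ h1))
  have hp := maxCodeSize_le_plotkin (n := n) (d := 2 * k) (by omega) (by omega)
  have h3 : 2 * k / (2 * (2 * k) - n) ≤ 2 := (Nat.div_le_iff_le_mul_add_pred (by omega)).2 (by omega)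
  omega

/-- **Odd twin**: `A(n, 2k − 1) = 4` for `3k ≤ n + 1 < 10k/3` (Theorem 2: `A(n, 2k−1) = A(n+1, 2k)`).
[cite: MacWilliamsSloane1977, Ch. 2 §2 Theorem 2 (p0043); §3 Theorem 8 (11) (p0047)] -/
theorem maxCodeSize_eq_four_odd (hk : 0 < k) (h1 : 3 * k ≤ n + 1) (h2 : 3 * (n + 1) < 10 * k) :
    maxCodeSize n (2 * k - 1) = 4 := by
  have hodd : Odd (2 * k - 1) := ⟨k - 1, by omega⟩
  rw [← maxCodeSize_succ_succ_of_odd n hodd, show 2 * k - 1 + 1 = 2 * k by omega]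
  exact maxCodeSize_eq_four hk h1 h2

/-- **Odd twin**: `A(n, d) = 2` for odd `d ≤ n` with `2(n + 1) < 3(d + 1)`. [cite: MacWilliamsSloane1977, Ch. 2 §2
Theorem 2 (p0043); §3 Theorem 8 (11) (p0047)] -/
theorem maxCodeSize_eq_two_odd (hd : Odd d) (hdn : d ≤ n) (h : 2 * (n + 1) < 3 * (d + 1)) : maxCodeSize n d = 2 := by
  rw [← maxCodeSize_succ_succ_of_odd n hd]
  exact maxCodeSize_eq_two (by omega) (Nat.succ_pos n) h

end General

/-! ### §2 Paley's Hadamard codes `𝒜_{p+1}`, `ℬ_{p+1}` for `p = 7, 11, 19, 23` -/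

section Complement

variable {κ : Type*} [Fintype κ]

/-- Complementing one word complements the distance: `dist(ū, v) = n − dist(u, v)`.
[cite: MacWilliamsSloane1977, Ch. 2 §3 "Hadamard codes" (ii)–(iii) (complements of codewords) (p0046)] -/
theorem hammingDist_not_left (u v : κ → Bool) :
    hammingDist (fun j => !u j) v = Fintype.card κ - hammingDist u v := by
  classical
  have h : (univ.filter fun j => (!u j) ≠ v j) = univ.filter fun j => ¬(u j ≠ v j) :=
    Finset.filter_congr fun j _ => by
      rcases Bool.eq_false_or_eq_true (u j) with hu | hu <;>
        rcases Bool.eq_false_or_eq_true (v j) with hv | hv <;> simp [hu, hv]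
  rw [hammingDist, hammingDist, h, Finset.filter_not, card_sdiff_of_subset (filter_subset _ _), card_univ]

/-- Complementing both words preserves the distance. [cite: MacWilliamsSloane1977, Ch. 2 §3 (iii) (p0046)] -/
theorem hammingDist_not_not (u v : κ → Bool) :
    hammingDist (fun j => !u j) (fun j => !v j) = hammingDist u v := by
  unfold hammingDist
  exact congrArg Finset.card (Finset.filter_congr fun j _ => by
      rcases Bool.eq_false_or_eq_true (u j) with hu | hu <;>
        rcases Bool.eq_false_or_eq_true (v j) with hv | hv <;> simp [hu, hv])

/-- A word and its complement differ everywhere. [cite: MacWilliamsSloane1977, Ch. 2 §3 (iii) (p0046)] -/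
theorem hammingDist_self_not (u : κ → Bool) : hammingDist u (fun j => !u j) = Fintype.card κ := by
  rw [hammingDist_comm, hammingDist_not_left, hammingDist_self, Nat.sub_zero]

end Complement

namespace Paley

variable (p : ℕ) [NeZero p]

/-- **Row `i` of the binary Paley matrix with its first column deleted**: the binary version (`+1 ↦ 0, −1 ↦ 1`)
of row `i` of `Q − I`, `Q = (χ(j − i))` the Jacobsthal matrix — bit `1` at `j` iff `j = i` or `j − i` is not a
square mod `p`. [cite: MacWilliamsSloane1977, Ch. 2 §3 Construction II, (8), and "Hadamard codes" (p0045–p0046)] -/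
def row (i : ZMod p) : ZMod p → Bool := fun j => decide (j = i) || !decide (∃ r : ZMod p, j - i = r * r)

/-- **`𝒜_{p+1}`**: the rows of the binary normalized Paley–Hadamard matrix of order `p + 1` with the first column
deleted — the zero word (first row) and the `p` rows of `Q − I`. [cite: MacWilliamsSloane1977, Ch. 2 §3 "Hadamard
codes" (i) (p0046)] -/
def codeA : Finset (ZMod p → Bool) := insert (fun _ => false) (univ.image (row p))

/-- **`ℬ_{p+1}`** = `𝒜_{p+1}` together with the complements of all its codewords. [cite: MacWilliamsSloane1977,
Ch. 2 §3 "Hadamard codes" (ii) (p0046)] -/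
def codeB : Finset (ZMod p → Bool) := codeA p ∪ (codeA p).image fun w j => !w j

/-- The kernel's certificate shape: all rows are at distance `e` from `0` and from each other ("any two rows of
`A_n` … have Hamming distance `½n` apart"). [cite: MacWilliamsSloane1977, Ch. 2 §3 "Hadamard codes" (p0046)] -/
def Cert (e : ℕ) : Prop :=
  (∀ i j : ZMod p, i ≠ j → hammingDist (row p i) (row p j) = e) ∧
    ∀ i : ZMod p, hammingDist (row p i) (fun _ => false) = e

/-- `H₈` (Paley, `p = 7`): rows pairwise at distance `4`. [cite: MacWilliamsSloane1977, Ch. 2 §3 Fig. 2.5, Fig. 2.7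
"the (7, 8, 4) code 𝒜₈" (p0046, p0048)] -/
theorem cert_seven : Cert 7 4 := by
  unfold Cert; decide +kernel

/-- `H₁₂` (Paley, `p = 11`): rows pairwise at distance `6`. [cite: MacWilliamsSloane1977, Ch. 2 §3 Fig. 2.5 (H₁₂);
§2 Example "(11, 12, 6) code 𝒜₁₂" (p0043, p0046)] -/
theorem cert_eleven : Cert 11 6 := by
  unfold Cert; decide +kernel

/-- `H₂₀` (Paley, `p = 19`): rows pairwise at distance `10`. [cite: MacWilliamsSloane1977, Ch. 2 §3 Construction II
("a Hadamard matrix of any order n = p + 1") (p0045)] -/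
theorem cert_nineteen : Cert 19 10 := by
  unfold Cert; decide +kernel

/-- `H₂₄` (Paley, `p = 23`): rows pairwise at distance `12`. [cite: MacWilliamsSloane1977, Ch. 2 §3 Construction II
(p0045)] -/
theorem cert_twentythree : Cert 23 12 := by
  unfold Cert; decide +kernel

variable {p} {e : ℕ}

/-- From the certificate: distinct words of `𝒜_{p+1}` are at distance exactly `e`. [cite: MacWilliamsSloane1977,
Ch. 2 §3 "Hadamard codes" (i): "an (n−1, n, ½n) code" (p0046)] -/
theorem hammingDist_of_mem_codeA (h : Cert p e) {u v : ZMod p → Bool} (hu : u ∈ codeA p) (hv : v ∈ codeA p)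
    (huv : u ≠ v) : hammingDist u v = e := by
  simp only [codeA, mem_insert, mem_image, mem_univ, true_and] at hu hv
  rcases hu with rfl | ⟨i, rfl⟩ <;> rcases hv with rfl | ⟨j, rfl⟩
  · exact absurd rfl huv
  · rw [hammingDist_comm]; exact h.2 j
  · exact h.2 i
  · exact h.1 i j fun hij => huv (by rw [hij])

/-- `𝒜_{p+1}` has `p + 1` words (`e ≥ 1`). [cite: MacWilliamsSloane1977, Ch. 2 §3 "Hadamard codes" (i) (p0046)] -/
theorem card_codeA (h : Cert p e) (he : 0 < e) : #(codeA p) = p + 1 := by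
  have hinj : Function.Injective (row p) := fun i j hij => by
    by_contra hne
    have := h.1 i j hne
    rw [hij, hammingDist_self] at this
    omega
  rw [codeA, card_insert_of_notMem, card_image_of_injective _ hinj, card_univ, ZMod.card]
  intro h0
  obtain ⟨i, -, hi⟩ := mem_image.1 h0
  have := h.2 i
  rw [hi, hammingDist_self] at this
  omega

/-- From the certificate: distinct words of `ℬ_{p+1}` are at distance `≥ p − e` (when `p ≤ 2e`): the distances
occurring are `e`, `p − e` and `p`. [cite: MacWilliamsSloane1977, Ch. 2 §3 "Hadamard codes" (ii): "an
(n−1, 2n, ½n − 1) code" (p0046)] -/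
theorem le_hammingDist_of_mem_codeB (h : Cert p e) (hep : p ≤ 2 * e) {u v : ZMod p → Bool} (hu : u ∈ codeB p)
    (hv : v ∈ codeB p) (huv : u ≠ v) : p - e ≤ hammingDist u v := by
  have hA := fun {u v} (hu : u ∈ codeA p) (hv : v ∈ codeA p) (huv : u ≠ v) => hammingDist_of_mem_codeA h hu hv huv
  have hcard : Fintype.card (ZMod p) = p := ZMod.card p
  rcases mem_union.1 hu with hu | hu <;> rcases mem_union.1 hv with hv | hv
  · rw [hA hu hv huv]; omega
  · obtain ⟨v₀, hv₀, rfl⟩ := mem_image.1 hv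
    rw [hammingDist_comm, hammingDist_not_left, hcard]
    by_cases h0 : v₀ = u
    · subst h0; rw [hammingDist_self]; omega
    · rw [hA hv₀ hu h0]
  · obtain ⟨u₀, hu₀, rfl⟩ := mem_image.1 hu
    rw [hammingDist_not_left, hcard]
    by_cases h0 : u₀ = v
    · subst h0; rw [hammingDist_self]; omega
    · rw [hA hu₀ hv h0]
  · obtain ⟨u₀, hu₀, rfl⟩ := mem_image.1 hu
    obtain ⟨v₀, hv₀, rfl⟩ := mem_image.1 hv
    rw [hammingDist_not_not, hA hu₀ hv₀ fun h0 => huv (by rw [h0])]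
    omega

/-- `ℬ_{p+1}` has `2(p + 1)` words (`1 ≤ e < p`: no word of `𝒜` is the complement of another).
[cite: MacWilliamsSloane1977, Ch. 2 §3 "Hadamard codes" (ii) (p0046)] -/
theorem card_codeB (h : Cert p e) (he : 0 < e) (hep : e < p) : #(codeB p) = 2 * (p + 1) := by
  have hinj : Function.Injective fun (w : ZMod p → Bool) (j : ZMod p) => !w j := fun w w' hw => by
    funext j
    have := congrFun hw j
    simpa using this
  rw [codeB, card_union_of_disjoint, card_image_of_injective _ hinj, card_codeA h he, two_mul]
  refine disjoint_left.2 fun w hw hw' => ?_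
  obtain ⟨u₀, hu₀, rfl⟩ := mem_image.1 hw'
  have hne : u₀ ≠ fun j => !u₀ j := fun h0 => by
    have := congrFun h0 0
    cases hb : u₀ 0 <;> simp [hb] at this
  have h1 := hammingDist_of_mem_codeA h hu₀ hw hne
  rw [hammingDist_self_not, ZMod.card] at h1
  omega

/-- **`A(p, e) ≥ p + 1`** from `𝒜_{p+1}`. [cite: MacWilliamsSloane1977, Ch. 2 §3 Theorem 8 (proof) (p0047)] -/
theorem succ_le_maxCodeSize (h : Cert p e) (he : 0 < e) : p + 1 ≤ maxCodeSize p e := by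
  have h' := card_le_maxCodeSize_of_equiv (ZMod.finEquiv p).toEquiv Function.injective_id (C := codeA p) (d := e)
    fun u hu v hv huv => (hammingDist_of_mem_codeA h (mem_coe.1 hu) (mem_coe.1 hv) huv).symm.le
  rwa [card_codeA h he] at h'

/-- **`A(p, p − e) ≥ 2(p + 1)`** from `ℬ_{p+1}`. [cite: MacWilliamsSloane1977, Ch. 2 §3 Theorem 8 (proof) (p0047)] -/
theorem two_mul_succ_le_maxCodeSize (h : Cert p e) (he : 0 < e) (hep : p ≤ 2 * e) (hep' : e < p) :
    2 * (p + 1) ≤ maxCodeSize p (p - e) := by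
  have h' := card_le_maxCodeSize_of_equiv (ZMod.finEquiv p).toEquiv Function.injective_id (C := codeB p)
    (d := p - e) fun u hu v hv huv => le_hammingDist_of_mem_codeB h hep (mem_coe.1 hu) (mem_coe.1 hv) huv
  rwa [card_codeB h he hep'] at h'

end Paley

/-! ### §3 Levenshtein's pasted codes `(17, 6, 10)`, `(20, 6, 12)`, `(21, 8, 12)` -/

namespace Pasted

/-- The word of length `n` whose letters are the binary digits of `a`. [folklore] -/
def ofNat (n a : ℕ) : Fin n → Bool := fun i => a.testBit i

/-- **`𝒜'₁₂ ⊕ 𝒜₈` restricted to six rows: a `(17, 6, 10)` code** (Theorem 8, case "n and k odd": `a = 1` copy of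
`𝒜'₁₂ = (10, 6, 6)` and `b = 1` copy of `𝒜₈ = (7, 8, 4)`; `n = 17`, `d = 10`, `M = 6`), as six numerals whose
binary digits are the words. [cite: MacWilliamsSloane1977, Ch. 2 §3 Theorem 8 (proof, (13)) (p0047–p0048)] -/
def nums17 : Finset ℕ := {0, 108427, 85175, 40302, 80604, 30577}

/-- **`𝒜'₁₂ ⊕ 𝒜'₁₂`: a `(20, 6, 12)` code.** [cite: MacWilliamsSloane1977, Ch. 2 §3 Theorem 8 (proof, case
"n even") (p0048)] -/
def nums20 : Finset ℕ := {0, 929675, 187575, 375150, 750300, 903025}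

/-- **`𝒜'₁₆ ⊕ 𝒜₈`: a `(21, 8, 12)` code.** [cite: MacWilliamsSloane1977, Ch. 2 §3 Theorem 8 (proof, case
"n odd, k even") (p0048)] -/
def nums21 : Finset ℕ := {0, 1733427, 1375292, 642831, 1294272, 478451, 951292, 1913039}

/-- The `(17, 6, 10)` certificate. [cite: MacWilliamsSloane1977, Ch. 2 §3 Theorem 8 (proof) (p0048)] -/
theorem cert17 : ∀ a ∈ nums17, ∀ b ∈ nums17, a ≠ b → 10 ≤ hammingDist (ofNat 17 a) (ofNat 17 b) := by
  decide +kernel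

/-- The `(20, 6, 12)` certificate. [cite: MacWilliamsSloane1977, Ch. 2 §3 Theorem 8 (proof) (p0048)] -/
theorem cert20 : ∀ a ∈ nums20, ∀ b ∈ nums20, a ≠ b → 12 ≤ hammingDist (ofNat 20 a) (ofNat 20 b) := by
  decide +kernel

/-- The `(21, 8, 12)` certificate. [cite: MacWilliamsSloane1977, Ch. 2 §3 Theorem 8 (proof) (p0048)] -/
theorem cert21 : ∀ a ∈ nums21, ∀ b ∈ nums21, a ≠ b → 12 ≤ hammingDist (ofNat 21 a) (ofNat 21 b) := by
  decide +kernel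

/-- **Transfer**: numerals pairwise encoding words at distance `≥ d ≥ 1` give `A(n, d) ≥` their number.
[cite: MacWilliamsSloane1977, Ch. 2 §3 Theorem 8 (proof: "The existence of this code establishes (9)") (p0048)] -/
theorem card_le_maxCodeSize {n d : ℕ} {s : Finset ℕ} (hd : 0 < d)
    (h : ∀ a ∈ s, ∀ b ∈ s, a ≠ b → d ≤ hammingDist (ofNat n a) (ofNat n b)) : #s ≤ maxCodeSize n d := by
  have hinj : Set.InjOn (ofNat n) s := fun a ha b hb hab => by
    by_contra hne
    have := h a ha b hb hne
    rw [hab, hammingDist_self] at this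
    omega
  rw [← card_image_of_injOn hinj]
  refine Literature.InformationTheory.Coding.card_le_maxCodeSize fun u hu v hv huv => ?_
  obtain ⟨a, ha, rfl⟩ := mem_image.1 (mem_coe.1 hu)
  obtain ⟨b, hb, rfl⟩ := mem_image.1 (mem_coe.1 hv)
  exact h a ha b hb fun hab => huv (by rw [hab])

end Pasted

/-! ### §4 The values -/

section Values

/-- `A(11, 6) = 12` (`𝒜₁₂`; Plotkin (3): `2⌊6/1⌋`). [cite: MacWilliamsSloane1977, Ch. 2 §2 Example (p0043); §3
Theorem 8 (9) (p0047)] -/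
theorem maxCodeSize_eleven_six : maxCodeSize 11 6 = 12 :=
  le_antisymm ((maxCodeSize_le_plotkin (by norm_num) (by norm_num)).trans (by norm_num))
    (Paley.succ_le_maxCodeSize Paley.cert_eleven (by norm_num))

/-- `A(11, 5) = 24` (`ℬ₁₂`; (6): `A(2d+1, d) ≤ 4d + 4`). [cite: MacWilliamsSloane1977, Appendix A Fig. 1 (p0522);
Ch. 2 §3 Theorem 8 (12) (p0047)] -/
theorem maxCodeSize_eleven_five : maxCodeSize 11 5 = 24 :=
  le_antisymm (by simpa using maxCodeSize_two_mul_add_one_le_of_odd (d := 5) (by decide))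
    (Paley.two_mul_succ_le_maxCodeSize Paley.cert_eleven (by norm_num) (by norm_num) (by norm_num))

/-- `A(12, 6) = 24` (`𝒞₁₂`; (10)). [cite: MacWilliamsSloane1977, Ch. 2 §3 Theorem 8 (10), d = 6 (p0047)] -/
theorem maxCodeSize_twelve_six : maxCodeSize 12 6 = 24 := by
  rw [maxCodeSize_succ_succ_of_odd 11 (by decide : Odd 5), maxCodeSize_eleven_five]

/-- `A(10, 6) = 6` (`𝒜'₁₂`; (9): `2⌊6/2⌋`). [cite: MacWilliamsSloane1977, Ch. 2 §3 Theorem 8 (9), Fig. 2.7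
"the (10, 6, 6) code 𝒜'₁₂" (p0047–p0048)] -/
theorem maxCodeSize_ten_six : maxCodeSize 10 6 = 6 := by
  refine le_antisymm ((maxCodeSize_le_plotkin (by norm_num) (by norm_num)).trans (by norm_num)) ?_
  have h := maxCodeSize_succ_le_two_mul 10 6
  rw [maxCodeSize_eleven_six] at h
  omega

/-- `A(10, 5) = 12`. [cite: MacWilliamsSloane1977, Appendix A Fig. 1 (p0522)] -/
theorem maxCodeSize_ten_five : maxCodeSize 10 5 = 12 := by
  rw [← maxCodeSize_succ_succ_of_odd 10 (by decide : Odd 5), maxCodeSize_eleven_six]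

/-- `A(9, 5) = 6`. [cite: MacWilliamsSloane1977, Appendix A Fig. 1 (p0522)] -/
theorem maxCodeSize_nine_five : maxCodeSize 9 5 = 6 := by
  rw [← maxCodeSize_succ_succ_of_odd 9 (by decide : Odd 5), maxCodeSize_ten_six]

/-- `A(9, 6) = 4`. [cite: MacWilliamsSloane1977, Ch. 2 §3 Theorem 8 (9), d = 6, n = 9 (p0047)] -/
theorem maxCodeSize_nine_six : maxCodeSize 9 6 = 4 := maxCodeSize_eq_four (k := 3) (by norm_num) (by norm_num) (by norm_num)

/-- `A(8, 5) = 4`. [cite: MacWilliamsSloane1977, Appendix A Fig. 1 (p0522)] -/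
theorem maxCodeSize_eight_five : maxCodeSize 8 5 = 4 := maxCodeSize_eq_four_odd (k := 3) (by norm_num) (by norm_num) (by norm_num)

/-- `A(7, 5) = A(6, 5) = A(5, 5) = 2`. [cite: MacWilliamsSloane1977, Appendix A Fig. 1 (p0522)] -/
theorem maxCodeSize_five_of_le (n : ℕ) (h5 : 5 ≤ n) (h7 : n ≤ 7) : maxCodeSize n 5 = 2 :=
  maxCodeSize_eq_two_odd (by decide) h5 (by omega)

/-- `A(6, 4) = 4`, `A(5, 3) = 4`. [cite: MacWilliamsSloane1977, Appendix A Fig. 1 (A(5,3) = 4) (p0522); Ch. 2 §3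
Theorem 8 (9) (p0047)] -/
theorem maxCodeSize_six_four : maxCodeSize 6 4 = 4 ∧ maxCodeSize 5 3 = 4 :=
  ⟨maxCodeSize_eq_four (k := 2) (by norm_num) (by norm_num) (by norm_num),
    maxCodeSize_eq_four_odd (k := 2) (by norm_num) (by norm_num) (by norm_num)⟩

/-- `A(14, 8) = 8` (`𝒜'₁₆`, here: shortening `A(15,8) = 16`; (9): `2⌊8/2⌋`). [cite: MacWilliamsSloane1977, Ch. 2
§3 Theorem 8 (9), d = 8, n = 14 (p0047)] -/
theorem maxCodeSize_fourteen_eight : maxCodeSize 14 8 = 8 := by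
  refine le_antisymm ((maxCodeSize_le_plotkin (by norm_num) (by norm_num)).trans (by norm_num)) ?_
  have h := maxCodeSize_succ_le_two_mul 14 8
  rw [HadamardCode.maxCodeSize_fifteen_eight] at h
  omega

/-- `A(13, 7) = 8`. [cite: MacWilliamsSloane1977, Appendix A Fig. 1 (p0522)] -/
theorem maxCodeSize_thirteen_seven : maxCodeSize 13 7 = 8 := by
  rw [← maxCodeSize_succ_succ_of_odd 13 (by decide : Odd 7), maxCodeSize_fourteen_eight]

/-- `A(13, 8) = A(12, 8) = 4`, `A(12, 7) = A(11, 7) = 4`. [cite: MacWilliamsSloane1977, Appendix A Fig. 1 (p0522);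
Ch. 2 §3 Theorem 8 (9), (11) (p0047)] -/
theorem maxCodeSize_eight_eq_four :
    maxCodeSize 13 8 = 4 ∧ maxCodeSize 12 8 = 4 ∧ maxCodeSize 12 7 = 4 ∧ maxCodeSize 11 7 = 4 :=
  ⟨maxCodeSize_eq_four (k := 4) (by norm_num) (by norm_num) (by norm_num),
    maxCodeSize_eq_four (k := 4) (by norm_num) (by norm_num) (by norm_num),
    maxCodeSize_eq_four_odd (k := 4) (by norm_num) (by norm_num) (by norm_num),
    maxCodeSize_eq_four_odd (k := 4) (by norm_num) (by norm_num) (by norm_num)⟩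

/-- `A(n, 7) = 2` for `7 ≤ n ≤ 10`. [cite: MacWilliamsSloane1977, Appendix A Fig. 1 (p0522)] -/
theorem maxCodeSize_seven_of_le (n : ℕ) (h7 : 7 ≤ n) (h10 : n ≤ 10) : maxCodeSize n 7 = 2 :=
  maxCodeSize_eq_two_odd (by decide) h7 (by omega)

/-- `A(19, 10) = 20` (`𝒜₂₀`; (9): `2⌊10/1⌋`). [cite: MacWilliamsSloane1977, Ch. 2 §3 Theorem 8 (9), d = 10, n = 19
(p0047)] -/
theorem maxCodeSize_nineteen_ten : maxCodeSize 19 10 = 20 :=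
  le_antisymm ((maxCodeSize_le_plotkin (by norm_num) (by norm_num)).trans (by norm_num))
    (Paley.succ_le_maxCodeSize Paley.cert_nineteen (by norm_num))

/-- `A(19, 9) = 40` (`ℬ₂₀`; (12)). [cite: MacWilliamsSloane1977, Appendix A Fig. 1 (A(19,9) = 40) (p0522); Ch. 2
§3 Theorem 8 (12), d = 9 (p0047)] -/
theorem maxCodeSize_nineteen_nine : maxCodeSize 19 9 = 40 :=
  le_antisymm (by simpa using maxCodeSize_two_mul_add_one_le_of_odd (d := 9) (by decide))
    (Paley.two_mul_succ_le_maxCodeSize Paley.cert_nineteen (by norm_num) (by norm_num) (by norm_num))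

/-- `A(20, 10) = 40` (`𝒞₂₀`; (10)). [cite: MacWilliamsSloane1977, Ch. 2 §3 Theorem 8 (10), d = 10 (p0047)] -/
theorem maxCodeSize_twenty_ten : maxCodeSize 20 10 = 40 := by
  rw [maxCodeSize_succ_succ_of_odd 19 (by decide : Odd 9), maxCodeSize_nineteen_nine]

/-- `A(18, 10) = 10` (`𝒜'₂₀`; (9): `2⌊10/2⌋`). [cite: MacWilliamsSloane1977, Ch. 2 §3 Theorem 8 (9), d = 10, n = 18
(p0047)] -/
theorem maxCodeSize_eighteen_ten : maxCodeSize 18 10 = 10 := by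
  refine le_antisymm ((maxCodeSize_le_plotkin (by norm_num) (by norm_num)).trans (by norm_num)) ?_
  have h := maxCodeSize_succ_le_two_mul 18 10
  rw [maxCodeSize_nineteen_ten] at h
  omega

/-- `A(17, 10) = 6` (the pasted `(17, 6, 10)` code; (9): `2⌊10/3⌋`). [cite: MacWilliamsSloane1977, Ch. 2 §3
Theorem 8 (9), d = 10, n = 17 (p0047–p0048)] -/
theorem maxCodeSize_seventeen_ten : maxCodeSize 17 10 = 6 :=
  le_antisymm ((maxCodeSize_le_plotkin (by norm_num) (by norm_num)).trans (by norm_num))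
    ((show 6 = #Pasted.nums17 by decide).le.trans (Pasted.card_le_maxCodeSize (by norm_num) Pasted.cert17))

/-- `A(16, 10) = A(15, 10) = 4`. [cite: MacWilliamsSloane1977, Ch. 2 §3 Theorem 8 (9), d = 10 (p0047)] -/
theorem maxCodeSize_ten_eq_four : maxCodeSize 16 10 = 4 ∧ maxCodeSize 15 10 = 4 :=
  ⟨maxCodeSize_eq_four (k := 5) (by norm_num) (by norm_num) (by norm_num),
    maxCodeSize_eq_four (k := 5) (by norm_num) (by norm_num) (by norm_num)⟩

/-- `A(n, 10) = 2` for `10 ≤ n ≤ 14`. [cite: MacWilliamsSloane1977, Ch. 2 §3 Theorem 8 (9), d = 10 (p0047)] -/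
theorem maxCodeSize_ten_of_le (n : ℕ) (h10 : 10 ≤ n) (h14 : n ≤ 14) : maxCodeSize n 10 = 2 :=
  maxCodeSize_eq_two h10 (by omega) (by omega)

/-- **The `d = 9` column of Appendix A Fig. 1 in the Plotkin range**: `A(18,9) = 20`, `A(17,9) = 10`, `A(16,9) = 6`,
`A(15,9) = A(14,9) = 4`. [cite: MacWilliamsSloane1977, Appendix A Fig. 1, d = 9 (p0522)] -/
theorem maxCodeSize_nine_column :
    maxCodeSize 18 9 = 20 ∧ maxCodeSize 17 9 = 10 ∧ maxCodeSize 16 9 = 6 ∧ maxCodeSize 15 9 = 4 ∧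
      maxCodeSize 14 9 = 4 := by
  refine ⟨?_, ?_, ?_, maxCodeSize_eq_four_odd (k := 5) (by norm_num) (by norm_num) (by norm_num),
    maxCodeSize_eq_four_odd (k := 5) (by norm_num) (by norm_num) (by norm_num)⟩
  · rw [← maxCodeSize_succ_succ_of_odd 18 (by decide : Odd 9), maxCodeSize_nineteen_ten]
  · rw [← maxCodeSize_succ_succ_of_odd 17 (by decide : Odd 9), maxCodeSize_eighteen_ten]
  · rw [← maxCodeSize_succ_succ_of_odd 16 (by decide : Odd 9), maxCodeSize_seventeen_ten]

/-- `A(n, 9) = 2` for `9 ≤ n ≤ 13`. [cite: MacWilliamsSloane1977, Appendix A Fig. 1, d = 9 (p0522)] -/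
theorem maxCodeSize_nine_of_le (n : ℕ) (h9 : 9 ≤ n) (h13 : n ≤ 13) : maxCodeSize n 9 = 2 :=
  maxCodeSize_eq_two_odd (by decide) h9 (by omega)

/-- `A(23, 12) = 24` (`𝒜₂₄`). [cite: MacWilliamsSloane1977, Ch. 2 §3 Theorem 8 (9), d = 12, n = 23 (p0047)] -/
theorem maxCodeSize_twentythree_twelve : maxCodeSize 23 12 = 24 :=
  le_antisymm ((maxCodeSize_le_plotkin (by norm_num) (by norm_num)).trans (by norm_num))
    (Paley.succ_le_maxCodeSize Paley.cert_twentythree (by norm_num))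

/-- `A(23, 11) = 48` (`ℬ₂₄`). [cite: MacWilliamsSloane1977, Ch. 2 §3 Theorem 8 (12), d = 11 (p0047)] -/
theorem maxCodeSize_twentythree_eleven : maxCodeSize 23 11 = 48 :=
  le_antisymm (by simpa using maxCodeSize_two_mul_add_one_le_of_odd (d := 11) (by decide))
    (Paley.two_mul_succ_le_maxCodeSize Paley.cert_twentythree (by norm_num) (by norm_num) (by norm_num))

/-- `A(24, 12) = 48` (`𝒞₂₄`). [cite: MacWilliamsSloane1977, Ch. 2 §3 Theorem 8 (10), d = 12 (p0047)] -/
theorem maxCodeSize_twentyfour_twelve : maxCodeSize 24 12 = 48 := by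
  rw [maxCodeSize_succ_succ_of_odd 23 (by decide : Odd 11), maxCodeSize_twentythree_eleven]

/-- `A(22, 12) = 12` (`𝒜'₂₄`, by shortening). [cite: MacWilliamsSloane1977, Ch. 2 §3 Theorem 8 (9), d = 12, n = 22
(p0047)] -/
theorem maxCodeSize_twentytwo_twelve : maxCodeSize 22 12 = 12 := by
  refine le_antisymm ((maxCodeSize_le_plotkin (by norm_num) (by norm_num)).trans (by norm_num)) ?_
  have h := maxCodeSize_succ_le_two_mul 22 12
  rw [maxCodeSize_twentythree_twelve] at h
  omega

/-- `A(21, 12) = 8` (the pasted `(21, 8, 12)` code). [cite: MacWilliamsSloane1977, Ch. 2 §3 Theorem 8 (9), d = 12,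
n = 21 (p0047–p0048)] -/
theorem maxCodeSize_twentyone_twelve : maxCodeSize 21 12 = 8 :=
  le_antisymm ((maxCodeSize_le_plotkin (by norm_num) (by norm_num)).trans (by norm_num))
    ((show 8 = #Pasted.nums21 by decide).le.trans (Pasted.card_le_maxCodeSize (by norm_num) Pasted.cert21))

/-- `A(20, 12) = 6` (the pasted `(20, 6, 12)` code). [cite: MacWilliamsSloane1977, Ch. 2 §3 Theorem 8 (9), d = 12,
n = 20 (p0047–p0048)] -/
theorem maxCodeSize_twenty_twelve : maxCodeSize 20 12 = 6 :=
  le_antisymm ((maxCodeSize_le_plotkin (by norm_num) (by norm_num)).trans (by norm_num))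
    ((show 6 = #Pasted.nums20 by decide).le.trans (Pasted.card_le_maxCodeSize (by norm_num) Pasted.cert20))

/-- `A(19, 12) = A(18, 12) = 4`; `A(n, 12) = 2` for `12 ≤ n ≤ 17`. [cite: MacWilliamsSloane1977, Ch. 2 §3 Theorem 8
(9), d = 12 (p0047)] -/
theorem maxCodeSize_twelve_small :
    maxCodeSize 19 12 = 4 ∧ maxCodeSize 18 12 = 4 ∧ ∀ n, 12 ≤ n → n ≤ 17 → maxCodeSize n 12 = 2 :=
  ⟨maxCodeSize_eq_four (k := 6) (by norm_num) (by norm_num) (by norm_num),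
    maxCodeSize_eq_four (k := 6) (by norm_num) (by norm_num) (by norm_num),
    fun n h12 h17 => maxCodeSize_eq_two h12 (by omega) (by omega)⟩

/-- **The `d = 11` column in the Plotkin range**: `A(22,11) = 24`, `A(21,11) = 12`, `A(20,11) = 8`, `A(19,11) = 6`,
`A(18,11) = A(17,11) = 4`, `A(n,11) = 2` for `11 ≤ n ≤ 16`. [cite: MacWilliamsSloane1977, Ch. 2 §3 Theorem 8 (11),
(12), d = 11 (p0047)] -/
theorem maxCodeSize_eleven_column :
    maxCodeSize 22 11 = 24 ∧ maxCodeSize 21 11 = 12 ∧ maxCodeSize 20 11 = 8 ∧ maxCodeSize 19 11 = 6 ∧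
      maxCodeSize 18 11 = 4 ∧ maxCodeSize 17 11 = 4 ∧ ∀ n, 11 ≤ n → n ≤ 16 → maxCodeSize n 11 = 2 := by
  refine ⟨?_, ?_, ?_, ?_, maxCodeSize_eq_four_odd (k := 6) (by norm_num) (by norm_num) (by norm_num),
    maxCodeSize_eq_four_odd (k := 6) (by norm_num) (by norm_num) (by norm_num),
    fun n h11 h16 => maxCodeSize_eq_two_odd (by decide) h11 (by omega)⟩
  · rw [← maxCodeSize_succ_succ_of_odd 22 (by decide : Odd 11), maxCodeSize_twentythree_twelve]
  · rw [← maxCodeSize_succ_succ_of_odd 21 (by decide : Odd 11), maxCodeSize_twentytwo_twelve]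
  · rw [← maxCodeSize_succ_succ_of_odd 20 (by decide : Odd 11), maxCodeSize_twentyone_twelve]
  · rw [← maxCodeSize_succ_succ_of_odd 19 (by decide : Odd 11), maxCodeSize_twenty_twelve]

end Values

end Literature.InformationTheory.Coding
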